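import Summits.BirchSwinnertonDyer.Rank1Residual.Ordinary.Conjectures.KolyvaginKimDatumOfEulerSystemLawAnyPrime
import Summits.BirchSwinnertonDyer.Rank1Residual.Ordinary.Conjectures.KolyvaginKimDatumOfEulerSystemBadPrimes
import HarnessLib

/-!
# LAW-2 and the Kolyvagin-class datum from an EULER SYSTEM of `T_pE` on the rows WITH ANOMALOUS BAD PLACES (n1011's THEOREM D″,
# prime-set condition `𝒫″`) at ANY ODD good non-anomalous PRIME `p`, THEOREM D″'s place-`p` certificate `htop` DISCHARGED —
# theorems only; nothing asserted; C-16 / the depth law stay CONJECTURES (cell `b2b-bsdres`, seat `b2b-bsdres-additive-p3` GEN 43, file F38)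

HONEST FRAMING (cell `b2b-bsdres`, run/shared/lean/b2b/bsd-rank1-residual/, verbatim in every
file): the goal of the cell is to DELETE the COMBINATION-SHAPED residual classes of the
Birch–Swinnerton-Dyer formula for ALL analytic-rank `≤ 1` elliptic curves over `ℚ` — "full BSD
formula for every rank `≤ 1` curve in class `C`" assembled STRICTLY from published theorems — so
that the rank-`≤ 1` remainder becomes exactly the CONSTRUCTION-SHAPED classes, which are TYPED
(missing-input `Prop`s), NOT attempted. This is not "finishing BSD". Seat `b2b-bsdres-additive-p3`
(X8 prover B / X7 joint; typer-designate for the cell conjecture C-16 = hyp C120.1; ladder BSD:K3 hand-off to cell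
`bsd-ssimc`; the lineage's ladder claim LAPSED at the D-0075 sunset 2026-08-27T06:00Z — this generation was seated after it and
does one bounded kernel step only). This file books nothing and moves no mark; X7 / X8 stay CONSTRUCTION-SHAPED; C-16 and the
depth law (`R1-DEPTH-LAW.md`) are CONJECTURES. NO Euler system is asserted to exist (binder `hc`).

## What this file does

F37 (`KolyvaginKimDatumOfEulerSystemLawAnyPrime.lean`) discharged THEOREM D's place-`p` certificate `htop` at every odd good
non-anomalous `p` on the rows served by n1011's THEOREM D (row certificate `hbad`: `E(ℚ_w)[p] = 0` at every bad `w ≠ p`).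
F33 (`KolyvaginKimDatumOfEulerSystemBadPrimes.lean`) composed the chain with n1011's THEOREM D″
(`GaloisImage/KolyvaginSystemOfEulerSystemPropagatedBad.lean`), which serves the complementary rows — those WITH an anomalous bad
place — by restricting the Kolyvagin primes instead (`hP''`: `p ∤ ord(w mod q)` for every `q ∈ 𝒫` and every bad `w ≠ p` carrying a
non-zero `ℚ_w`-rational `p`-torsion point), but F33's generic-prime datum still displayed `htop`, and NO LAW-2 END existed for these
rows at any `p`. This file is the `𝒫″` companion of F37:

* §1 **`kolyvaginKimDatum_of_isEulerSystem_of_primes''_canonicalTop`** — F33 §1 (the datum `KolyvaginKimDatum W f p ℓ k₀ (k+1) Q vℓ vp ψ`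
  from an Euler system of `T_pE` under `𝒫″`, any odd `p`) with `htop` DISCHARGED from the two letter clauses `p ∤ Δ_min`,
  `p ∤ #Ẽ(𝔽_p)` (binders `hgoodp`, `hna`; F37 §1 `propagatedSelmerStructure_eq_top_of_not_dvd_reductionPointCount` = Mazur–Rubin
  Lemma A.1 at every level, generic prime, GaloisImage F36). THEOREM D″ takes no reduction tower and no row certificate, so NO
  curve-level certificate of the «Euler system ⇒ Kolyvagin system» step is displayed at all: every remaining binder is letter data,
  the Euler system `c` (Kato's — NOT asserted), `Irr(E[p])`, THE CANONICAL datum with `𝒫″`, F30's binders and the ONE reading hypothesis.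
* §2 **`zmodPowOrd_kuriharaNumber_eq_of_isEulerSystem_of_primes''_canonicalTop`** — LAW-2 at `(ℓ, k₀)`,
  `ord_p(δ̃_ℓ mod p^{k₀}) = min(k₀, F + 2·v_ℓ(P))` (any formal level `m = m_p(P)`, derived regime) on the `𝒫″` rows: F25's consumer
  `zmodPowOrd_kuriharaNumber_eq_of_kolyvaginKimDatum` ∘ §1. Signature = F37 §3 with `hbad` replaced by `hP''`. Displayed inputs =
  Poitou–Tate ∧ local Euler characteristic (published named facts) ∧ letter data ∧ «an Euler system of `T_pE` over the cyclotomic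
  levels (binder; Kato, Astérisque 295 Thm. 8.1/12.5 at `p ≥ 5`) + THE CANONICAL Kolyvagin datum `∋ vℓ` whose primes satisfy `𝒫″` +
  Sakamoto's `(Sτ, τ)` + the divisibility witness + the two readings of the derived classes (bottom class MR Thm. 5.2.12; Kim
  Thm. 3.13 + (5.3), print for `p ≥ 5`)» — the K3 typer's T1′/T2′/T3′ — and nothing else.
* §3 **`kolyvaginPrimeCondition''_of_torsion_eq_zero_bad`** — the condition `𝒫″` is VACUOUS on the rows with `hbad` (no bad `w ≠ p`
  carries a non-zero `p`-torsion point over `ℚ_w`), so §2 serves EVERY row: F37 §3 is the special case `hP'' := §3 hbad`. With F37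
  and this file, at EVERY odd good non-anomalous `p` and on EVERY curve of the letter the chain's ENDs display no artefact of the
  «Euler system ⇒ Kolyvagin system» step beyond the choice of Kolyvagin primes (`𝒫 ⊆` level primes ∩ Kato's Kolyvagin primes ∩ `𝒫″`,
  a positive-density Chebotarev set, ROUTE-1 §43.5 / §45.4 — chosen by the typer together with the datum). No new mathematics here
  (F33 §1 and F25 applied to F37 §1); the depth law itself stays a CONJECTURE of the cell.

References: B. Mazur, K. Rubin, Mem. AMS 799 (2004), Def. 3.2.1, Thm. 3.2.4, Thm. 5.2.12, App. A Lemma A.1 [MazurRubin2004];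
K. Kato, Astérisque 295 (2004), Thm. 8.1, Thm. 12.5 [Kato2004Asterisque]; K. Rubin, *Euler Systems* (2000) Def. 2.1.1,
Thm. 4.5.1, §4.4 [Rubin2000]; R. Sakamoto, JTNB 36 (2024) §2, Def. 4.1 [Sakamoto2024]; C.-H. Kim, arXiv:2203.12159, Thm. 3.13,
(5.3) [Kim2022StructureSelmer]; J. S. Milne, ADT (2006) I 2.8, 4.10(b) [MilneADT2006]; J. H. Silverman, AEC (2009) IV.6.1,
VII.2.1 [SilvermanAEC2009].
-/

noncomputable section

open CategoryTheory Function Finset Field IsDedekindDomain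
open scoped NumberField Classical ContRepresentation MatrixGroups
open CongruenceSubgroup WeierstrassCurve Literature.NumberTheory.EllipticCurves
  Literature.NumberTheory.EllipticCurves.ModularForms
  Literature.NumberTheory.EllipticCurves.Rank1Residual
  Literature.NumberTheory.GaloisRepresentations Literature.NumberTheory.GaloisCohomology
  Literature.NumberTheory.GaloisRepresentations.DiscreteGaloisModule
  NumberField
  Summit.BirchSwinnertonDyer.Rank1Residual.GaloisImage
  Summit.BirchSwinnertonDyer.Rank1Residual.GaloisImage.CoeffTransport
  Summit.BirchSwinnertonDyer.Rank1Residual.GaloisImage.CyclotomicLevel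
  Summit.BirchSwinnertonDyer.Rank1Residual.GaloisImage.TorsionCoeff
  Rat.HeightOneSpectrum

namespace Summit.BirchSwinnertonDyer.Rank1Residual.Ordinary

variable (W : WeierstrassCurve ℚ) [W.IsElliptic] [W.IsGloballyMinimal] (p : ℕ) [hp : Fact p.Prime]
variable [Module.Free ℤ_[p] (W.tateModule p)] [Module.Finite ℤ_[p] (W.tateModule p)]
  [ContinuousSMul ℤ_[p] (W.tateModule p)]

/-- Local notation: `T∞ = T_p E` as a continuous `G_ℚ`-representation (as in n1011's THEOREM D files). -/
local notation3 "T∞" => WeierstrassCurve.tateGaloisRep W p (W.continuous_galoisRepTate_holds p)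

variable (S : Set (HeightOneSpectrum (𝓞 ℚ)))

/-- Local notation: `𝓛` = the cyclotomic Euler-system levels `ℚ(μ_{p^{n+1}}, μ_r)`, `r ∩ S = ∅`. -/
local notation3 "𝓛" => cyclotomicLevelsRat p S

/-- Local notation: `𝐃ℤ⟦X, U, τ⟧ ℓ = ∑_{j < ℓ−1} j·(τ_ℓ)_*^j` on `H¹(U, X)` (`ℤ`-linear), Kolyvagin's derivative operator. -/
local notation3 (prettyPrint := false) "𝐃ℤ⟦" X ", " U ", " τ "⟧" =>
  fun ℓ : HeightOneSpectrum (𝓞 ℚ) =>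
  ∑ j ∈ Finset.range (((primesEquiv ℓ : Nat.Primes) : ℕ) - 1),
    (j : Module.End ℤ (continuousCohomology 1 (subgroupRep X U))) *
      (conjMap X U ((τ : HeightOneSpectrum (𝓞 ℚ) → absoluteGaloisGroup ℚ) ℓ) 1).hom.toLinearMap ^ j

/-- Local notation: the level-`j` reduction `red_j : T_pE ⟶ E[p^j]_{ℤ_p}` (n1011 GZ-2). -/
local notation3 "𝐫𝐞𝐝⟦" j "⟧" => tateModuleRed W p (W.continuous_galoisRepTate_holds p) j

/-! ### §1 The datum from an Euler system of `T_pE` under `𝒫″`, any odd good non-anomalous `p`, `htop` discharged -/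

section Datum

variable {N : ℕ} (f : CuspForm (Gamma0 N) 2) (ℓ k₀ k : ℕ) [Fact ℓ.Prime] (Q : W.toAffine.Point)
  (vℓ vp : HeightOneSpectrum (𝓞 ℚ)) (ψ : (q : ℕ) → (ZMod q)ˣ →* Multiplicative (ZMod (p ^ k₀)))

/-- **`KolyvaginKimDatum` at depth `k + 1` for ANY ODD good non-anomalous PRIME `p` from an EULER SYSTEM of `T_pE` over the cyclotomic
levels on the rows WITH ANOMALOUS BAD PLACES allowed (`𝒫″`), THEOREM D″'s place-`p` certificate `htop` DISCHARGED** — F33 §1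
`kolyvaginKimDatum_of_isEulerSystem_of_primes''` with `htop` supplied by F37 §1 `propagatedSelmerStructure_eq_top_of_not_dvd_reductionPointCount`
from the two letter clauses `p ∤ Δ_min`, `p ∤ #Ẽ(𝔽_p)` (binders `hgoodp`, `hna`). Binders left: the Euler system `c` (Kato's — NOT
asserted), `Irr(E[p])`, THE CANONICAL Kolyvagin datum `D` on `E[p^k·p]` (cyclotomic transverse conditions, canonical comparison maps,
`𝒫 ⊆` level primes ∩ Kato's Kolyvagin primes) with the prime-set condition `hP''` (`p ∤ ord(w mod q)` for `q ∈ 𝒫` and every bad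
`w ≠ p` carrying a non-zero `ℚ_w`-rational `p`-torsion point — it REPLACES THEOREM D's row certificate `hbad`), F30's binders
(Sakamoto's `(Sτ, τ)`, `vℓ ∈ 𝒫` good with `vℓ ∤ p`, `vp ∋ p`, `hdiv`) and the ONE reading hypothesis `hread` (bottom class —
Mazur–Rubin Thm. 5.2.12 — and Kim's reading of `κ_{vℓ}` at `vp` — Kim Thm. 3.13 + (5.3), print for `p ≥ 5`). NO curve-level
certificate of the «Euler system ⇒ Kolyvagin system» step is displayed. Nothing asserted.
[cite: MazurRubin2004, Thm. 3.2.4, Thm. 5.2.12 and App. A, Lemma A.1 (p. 79)] [cite: Rubin2000, Thm. 4.5.1]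
[cite: Kim2022StructureSelmer, Thm. 3.13 and (5.3)] [cite: Sakamoto2024, §2 (p. 921) and Def. 4.1 (p. 926)]
[cite: SilvermanAEC2009, IV.6.1 and Prop. VII.2.1] -/
theorem kolyvaginKimDatum_of_isEulerSystem_of_primes''_canonicalTop (hp2 : p ≠ 2)
    (hgoodp : ¬ (p : ℤ) ∣ minimalDiscriminantInt W) (hna : ¬ p ∣ W.reductionPointCount p)
    -- the Euler system and THEOREM D″'s binders (`htop` is DISCHARGED below; `hbad` is replaced by `hP''`)
    {c : ∀ (i : ℕ) (r : (𝓛).Ideals), H1 T∞ ((𝓛).level i r.1)}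
    (hc : IsEulerSystem 𝓛 T∞ p c) (hirr : W.HasIrreducibleModPGaloisRep p)
    (D : KolyvaginDatum (W.torsionGaloisModule ((p : ℤ) ^ k * (p : ℤ))))
    (hT : D.transverse = cyclotomicTransverse (W.torsionGaloisModule ((p : ℤ) ^ k * (p : ℤ))))
    {η : (q : HeightOneSpectrum (𝓞 ℚ)) → (ZMod (Ideal.absNorm q.asIdeal))ˣ}
    (hD : D.HasCanonicalComparison (p ^ (k + 1)) η)
    (hPr : D.primes ⊆ (𝓛).primes)
    (hKol : ∀ q ∈ D.primes, Kato.IsKolyvaginPrime W p (k + 1) ((primesEquiv q : Nat.Primes) : ℕ))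
    (hP'' : ∀ q ∈ D.primes, ∀ w : HeightOneSpectrum (𝓞 ℚ), ¬ W.HasGoodReductionAt w →
      ((primesEquiv w : Nat.Primes) : ℕ) ≠ p →
      (∃ P : (W.baseChange (w.adicCompletion ℚ)).toAffine.Point, p • P = 0 ∧ P ≠ 0) →
        ¬ p ∣ orderOf ((((primesEquiv w : Nat.Primes) : ℕ) : ZMod ((primesEquiv q : Nat.Primes) : ℕ))))
    -- F30's binders: Sakamoto's `τ`-class for the canonical datum, the place `vℓ`, the divisibility witness
    (Sτ : Set (HeightOneSpectrum (𝓞 ℚ))) {τ : absoluteGaloisGroup ℚ}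
    (hτq : Nonempty (cokerSubOne (W.torsionGaloisModule ((p : ℤ) ^ k * (p : ℤ))) τ ≃+ ZMod (p ^ (k + 1))))
    (hτμ : τ ∈ rootsOfUnityFixer ℚ (p ^ (k + 1)))
    (hP : D.primes ⊆ frobeniusClassPrimes (W.torsionGaloisModule ((p : ℤ) ^ k * (p : ℤ))) Sτ τ (p ^ (k + 1)))
    (hDℓ : vℓ ∈ D.primes)
    (hdiv : ∀ X : geomPoints W, ∃ R : geomPoints W, ((p : ℤ) ^ k * (p : ℤ)) • R = X)
    (hpv : ((p : ℕ) : 𝓞 ℚ) ∉ vℓ.asIdeal) (hgood : W.HasGoodReductionAt vℓ) (hvp : ((p : ℕ) : 𝓞 ℚ) ∈ vp.asIdeal)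
    -- the two READINGS of the derived system: bottom class (MR Thm. 5.2.12) and Kim's reading (Thm. 3.13 + (5.3))
    (hread : letI := TorsionCoeff.torsionBy.padicIntModule p (k + 1) (WeierstrassCurve.geomPoints W)
      ∀ (σ : HeightOneSpectrum (𝓞 ℚ) → absoluteGaloisGroup ℚ)
        (Φ : ∀ r : Finset (HeightOneSpectrum (𝓞 ℚ)),
          continuousCohomology 1 (subgroupRep (torsionRepPadicInt W p (k + 1)).toTopRep ((𝓛).level ⊥ r)) →+
            continuousCohomology 1 (subgroupRep
              (W.torsionGaloisModule ((p : ℤ) ^ k * (p : ℤ))).toTopRep ((𝓛).level ⊥ r)))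
        (comm : ∀ r : Finset (HeightOneSpectrum (𝓞 ℚ)),
          ((r : Finset _) : Set (HeightOneSpectrum (𝓞 ℚ))).Pairwise fun a b =>
            Commute (𝐃ℤ⟦(W.torsionGaloisModule ((p : ℤ) ^ k * (p : ℤ))).toTopRep, ((𝓛).level ⊥ r), σ⟧ a)
              (𝐃ℤ⟦(W.torsionGaloisModule ((p : ℤ) ^ k * (p : ℤ))).toTopRep, ((𝓛).level ⊥ r), σ⟧ b))
        (κ : Finset (HeightOneSpectrum (𝓞 ℚ)) →
          galoisCohomology (W.torsionGaloisModule ((p : ℤ) ^ k * (p : ℤ))) 1),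
        (∀ q, σ q ∈ (adicCompletionPrime ℚ q).inertia (absoluteGaloisGroup ℚ)) →
        (∀ q, modNCyclotomicCharacter ℚ (Ideal.absNorm q.asIdeal) (σ q) = η q) →
        (∀ r, ∀ (φ : contOneCocycles (subgroupRep (torsionRepPadicInt W p (k + 1)).toTopRep ((𝓛).level ⊥ r)))
          (ψ' : contOneCocycles (subgroupRep
            (W.torsionGaloisModule ((p : ℤ) ^ k * (p : ℤ))).toTopRep ((𝓛).level ⊥ r))),
          (∀ g, ψ'.1 g = AddSubgroup.inclusion (geomTorsion_pow_succ_eq W p k).le (φ.1 g)) →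
            Φ r (oneCocycleClass _ φ) = oneCocycleClass _ ψ') →
        D.IsKolyvaginSystem (propagatedSelmerStructure W p k) κ →
        (∀ r : Finset (HeightOneSpectrum (𝓞 ℚ)), ¬ (↑r : Set _) ⊆ D.primes → κ r = 0) →
        (∀ (r : Finset (HeightOneSpectrum (𝓞 ℚ))) (hr : (↑r : Set _) ⊆ D.primes),
          resSubgroup (W.torsionGaloisModule ((p : ℤ) ^ k * (p : ℤ))).toTopRep ((𝓛).level ⊥ r) 1
              (κ r) =
            (r.noncommProd 𝐃ℤ⟦(W.torsionGaloisModule ((p : ℤ) ^ k * (p : ℤ))).toTopRep,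
                ((𝓛).level ⊥ r), σ⟧ (comm r))
              (Φ r (ContinuousCohomology.map (ContinuousMonoidHom.id _)
                (X := subgroupRep T∞.toTopRep ((𝓛).level ⊥ r))
                (Y := subgroupRep (torsionRepPadicInt W p (k + 1)).toTopRep ((𝓛).level ⊥ r))
                ((TopRep.resFunctor ((𝓛).level ⊥ r).subtype).map 𝐫𝐞𝐝⟦k + 1⟧) 1
                (c ⊥ ⟨r, fun _ hq => hPr (hr (Finset.mem_coe.2 hq))⟩)))) →
        κ ∅ = kummerMapTorsion W ((p : ℤ) ^ k * (p : ℤ)) hdiv Q ∧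
        ∀ ψp : galoisCohomology ((W.torsionGaloisModule ((p : ℤ) ^ k * (p : ℤ))).toLocal (Sum.inr vp)) 1 ⧸
            W.kummerSelmerStructure ((p : ℤ) ^ k * (p : ℤ)) (Sum.inr vp) ≃+ ZMod (p ^ (k + 1)),
          (haveI : NeZero ℓ := ⟨(Fact.out : ℓ.Prime).ne_zero⟩
           zmodPowOrd p k₀ (kuriharaNumber f (p ^ k₀) ℓ ψ)) =
            min k₀ (zmodPowOrd p (k + 1)
              (ψp (galoisCohomology.localization (W.torsionGaloisModule ((p : ℤ) ^ k * (p : ℤ)))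
                (Sum.inr vp) 1 (κ {vℓ}))))) :
    KolyvaginKimDatum W f p ℓ k₀ (k + 1) Q vℓ vp ψ := by
  have htop : ∀ w : HeightOneSpectrum (𝓞 ℚ), ((primesEquiv w : Nat.Primes) : ℕ) = p →
      propagatedSelmerStructure W p k (Sum.inr w) = ⊤ := fun w hw =>
    propagatedSelmerStructure_eq_top_of_not_dvd_reductionPointCount W p hp2 hgoodp hna k w hw
  exact kolyvaginKimDatum_of_isEulerSystem_of_primes'' W p S f ℓ k₀ k Q vℓ vp ψ hp2 hc hirr D hT hD hPr hKol hP'' htop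
    Sτ hτq hτμ hP hDℓ hdiv hpv hgood hvp hread

end Datum

/-! ### §2 LAW-2 at `(ℓ, k₀)` on the `𝒫″` rows for any odd good non-anomalous `p` from an Euler system of `T_pE`, `htop` discharged -/

section Law

variable {N : ℕ} (f : CuspForm (Gamma0 N) 2) (ℓ k₀ k : ℕ) [Fact ℓ.Prime] (P : W.toAffine.Point) (F m : ℕ)
  (vℓ vp : HeightOneSpectrum (𝓞 ℚ)) (ψ : (q : ℕ) → (ZMod q)ˣ →* Multiplicative (ZMod (p ^ k₀)))

/-- **LAW-2 at `(ℓ, k₀)` from an EULER SYSTEM of `T_pE` on the rows WITH ANOMALOUS BAD PLACES allowed (`𝒫″`), any odd good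
non-anomalous `p`, THEOREM D″'s place-`p` certificate `htop` DISCHARGED** — F25's consumer `zmodPowOrd_kuriharaNumber_eq_of_kolyvaginKimDatum`
applied to §1 for `Q = (p^{m+F}·u)·P`: `ord_p(δ̃_ℓ mod p^{k₀}) = min(k₀, F + 2·v_ℓ(P))` for any formal level `m = m_p(P)` in the
derived regime, from Poitou–Tate over `ℚ`, the local Euler characteristic at `vℓ` and `vp`, the letter data (`hgoodp : p ∤ Δ_min`,
`hna : p ∤ #Ẽ(𝔽_p)`, `hm1`/`hm2`, `ℓ` cyclic with `ℓ ∈ 𝒫_{k+1}`, `k₀ ≤ k+1`, `p ∤ u`, `hreg`), an Euler system `c` of `T_pE` over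
the cyclotomic levels (Kato's — a binder, NOT asserted), `Irr(E[p])`, THE CANONICAL datum `D ∋ vℓ` whose primes satisfy the
prime-set condition `hP''` (in place of THEOREM D's row certificate `hbad` of F37 §3 — the signature is F37 §3 with `hbad ↦ hP''`),
Sakamoto's `(Sτ, τ)`, the divisibility witness, and the reading hypothesis on every derived system (bottom class `κ((p^{m+F}·u)·P)`,
MR Thm. 5.2.12; Kim's reading of `κ_{vℓ}` at `vp`, Thm. 3.13 + (5.3)). By §3 the condition `hP''` is vacuous on the `hbad` rows, so
this END serves every row. At `p ≥ 5` every displayed input is print; the law stays a CONJECTURE of the cell (nothing here asserts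
its inputs). [cite: MazurRubin2004, Thm. 3.2.4, Thm. 5.2.12 and App. A] [cite: Rubin2000, Thm. 4.5.1]
[cite: Kim2022StructureSelmer, Thm. 3.13 and (5.3)] [cite: MilneADT2006, Ch. I, Thm. 4.10(b) and Thm. 2.8]
[cite: Sakamoto2024, §2 (p. 921) and Def. 4.1 (p. 926)] [cite: SilvermanAEC2009, IV.6.1 and Prop. VII.2.1] -/
theorem zmodPowOrd_kuriharaNumber_eq_of_isEulerSystem_of_primes''_canonicalTop (hp2 : p ≠ 2)
    (hgoodp : ¬ (p : ℤ) ∣ minimalDiscriminantInt W) (hna : ¬ p ∣ W.reductionPointCount p)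
    (hm1 : W.reductionPointCount p • Affine.Point.map (W' := W.toAffine) (Algebra.ofId ℚ ℚ_[p]) P ∈
      (W.baseChange ℚ_[p]).formalFiltration (m + 1))
    (hm2 : W.reductionPointCount p • Affine.Point.map (W' := W.toAffine) (Algebra.ofId ℚ ℚ_[p]) P ∉
      (W.baseChange ℚ_[p]).formalFiltration (m + 2))
    (hcycℓ : IsCyclicKolyvaginLevel W p ℓ)
    (hvℓ : (ℓ : 𝓞 ℚ) ∈ vℓ.asIdeal) (hvp : ((p : ℕ) : 𝓞 ℚ) ∈ vp.asIdeal)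
    (hPT : poitouTate_sum_localTatePairing_eq_zero ℚ)
    (hEPℓ : localEulerPoincareCharacteristic (vℓ.adicCompletion ℚ))
    (hEPp : localEulerPoincareCharacteristic (vp.adicCompletion ℚ))
    (hk : k₀ ≤ k + 1) (hKP : Kato.IsKolyvaginPrime W p (k + 1) ℓ) {u : ℕ} (hu : ¬ p ∣ u)
    (hreg : m = 0 ∨ m + F + 2 * localDivExponent W p ℓ P < k + 1)
    -- the Euler system and THEOREM D″'s binders (`htop` DISCHARGED below; the row certificate `hbad` REPLACED by the prime-set condition `hP''`)
    {c : ∀ (i : ℕ) (r : (𝓛).Ideals), H1 T∞ ((𝓛).level i r.1)}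
    (hc : IsEulerSystem 𝓛 T∞ p c) (hirr : W.HasIrreducibleModPGaloisRep p)
    (D : KolyvaginDatum (W.torsionGaloisModule ((p : ℤ) ^ k * (p : ℤ))))
    (hT : D.transverse = cyclotomicTransverse (W.torsionGaloisModule ((p : ℤ) ^ k * (p : ℤ))))
    {η : (q : HeightOneSpectrum (𝓞 ℚ)) → (ZMod (Ideal.absNorm q.asIdeal))ˣ}
    (hD : D.HasCanonicalComparison (p ^ (k + 1)) η)
    (hPr : D.primes ⊆ (𝓛).primes)
    (hKol : ∀ q ∈ D.primes, Kato.IsKolyvaginPrime W p (k + 1) ((primesEquiv q : Nat.Primes) : ℕ))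
    (hP'' : ∀ q ∈ D.primes, ∀ w : HeightOneSpectrum (𝓞 ℚ), ¬ W.HasGoodReductionAt w →
      ((primesEquiv w : Nat.Primes) : ℕ) ≠ p →
      (∃ P : (W.baseChange (w.adicCompletion ℚ)).toAffine.Point, p • P = 0 ∧ P ≠ 0) →
        ¬ p ∣ orderOf ((((primesEquiv w : Nat.Primes) : ℕ) : ZMod ((primesEquiv q : Nat.Primes) : ℕ))))
    -- Sakamoto's `τ`-class for the canonical datum, `vℓ ∈ 𝒫`, the divisibility witness
    (Sτ : Set (HeightOneSpectrum (𝓞 ℚ))) {τ : absoluteGaloisGroup ℚ}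
    (hτq : Nonempty (cokerSubOne (W.torsionGaloisModule ((p : ℤ) ^ k * (p : ℤ))) τ ≃+ ZMod (p ^ (k + 1))))
    (hτμ : τ ∈ rootsOfUnityFixer ℚ (p ^ (k + 1)))
    (hP : D.primes ⊆ frobeniusClassPrimes (W.torsionGaloisModule ((p : ℤ) ^ k * (p : ℤ))) Sτ τ (p ^ (k + 1)))
    (hDℓ : vℓ ∈ D.primes)
    (hdiv : ∀ X : geomPoints W, ∃ R : geomPoints W, ((p : ℤ) ^ k * (p : ℤ)) • R = X)
    -- the two READINGS of the derived system, for `Q = (p^{m+F}·u)·P`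
    (hread : letI := TorsionCoeff.torsionBy.padicIntModule p (k + 1) (WeierstrassCurve.geomPoints W)
      ∀ (σ : HeightOneSpectrum (𝓞 ℚ) → absoluteGaloisGroup ℚ)
        (Φ : ∀ r : Finset (HeightOneSpectrum (𝓞 ℚ)),
          continuousCohomology 1 (subgroupRep (torsionRepPadicInt W p (k + 1)).toTopRep ((𝓛).level ⊥ r)) →+
            continuousCohomology 1 (subgroupRep
              (W.torsionGaloisModule ((p : ℤ) ^ k * (p : ℤ))).toTopRep ((𝓛).level ⊥ r)))
        (comm : ∀ r : Finset (HeightOneSpectrum (𝓞 ℚ)),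
          ((r : Finset _) : Set (HeightOneSpectrum (𝓞 ℚ))).Pairwise fun a b =>
            Commute (𝐃ℤ⟦(W.torsionGaloisModule ((p : ℤ) ^ k * (p : ℤ))).toTopRep, ((𝓛).level ⊥ r), σ⟧ a)
              (𝐃ℤ⟦(W.torsionGaloisModule ((p : ℤ) ^ k * (p : ℤ))).toTopRep, ((𝓛).level ⊥ r), σ⟧ b))
        (κ : Finset (HeightOneSpectrum (𝓞 ℚ)) →
          galoisCohomology (W.torsionGaloisModule ((p : ℤ) ^ k * (p : ℤ))) 1),
        (∀ q, σ q ∈ (adicCompletionPrime ℚ q).inertia (absoluteGaloisGroup ℚ)) →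
        (∀ q, modNCyclotomicCharacter ℚ (Ideal.absNorm q.asIdeal) (σ q) = η q) →
        (∀ r, ∀ (φ : contOneCocycles (subgroupRep (torsionRepPadicInt W p (k + 1)).toTopRep ((𝓛).level ⊥ r)))
          (ψ' : contOneCocycles (subgroupRep
            (W.torsionGaloisModule ((p : ℤ) ^ k * (p : ℤ))).toTopRep ((𝓛).level ⊥ r))),
          (∀ g, ψ'.1 g = AddSubgroup.inclusion (geomTorsion_pow_succ_eq W p k).le (φ.1 g)) →
            Φ r (oneCocycleClass _ φ) = oneCocycleClass _ ψ') →
        D.IsKolyvaginSystem (propagatedSelmerStructure W p k) κ →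
        (∀ r : Finset (HeightOneSpectrum (𝓞 ℚ)), ¬ (↑r : Set _) ⊆ D.primes → κ r = 0) →
        (∀ (r : Finset (HeightOneSpectrum (𝓞 ℚ))) (hr : (↑r : Set _) ⊆ D.primes),
          resSubgroup (W.torsionGaloisModule ((p : ℤ) ^ k * (p : ℤ))).toTopRep ((𝓛).level ⊥ r) 1
              (κ r) =
            (r.noncommProd 𝐃ℤ⟦(W.torsionGaloisModule ((p : ℤ) ^ k * (p : ℤ))).toTopRep,
                ((𝓛).level ⊥ r), σ⟧ (comm r))
              (Φ r (ContinuousCohomology.map (ContinuousMonoidHom.id _)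
                (X := subgroupRep T∞.toTopRep ((𝓛).level ⊥ r))
                (Y := subgroupRep (torsionRepPadicInt W p (k + 1)).toTopRep ((𝓛).level ⊥ r))
                ((TopRep.resFunctor ((𝓛).level ⊥ r).subtype).map 𝐫𝐞𝐝⟦k + 1⟧) 1
                (c ⊥ ⟨r, fun _ hq => hPr (hr (Finset.mem_coe.2 hq))⟩)))) →
        κ ∅ = kummerMapTorsion W ((p : ℤ) ^ k * (p : ℤ)) hdiv ((p ^ (m + F) * u) • P) ∧
        ∀ ψp : galoisCohomology ((W.torsionGaloisModule ((p : ℤ) ^ k * (p : ℤ))).toLocal (Sum.inr vp)) 1 ⧸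
            W.kummerSelmerStructure ((p : ℤ) ^ k * (p : ℤ)) (Sum.inr vp) ≃+ ZMod (p ^ (k + 1)),
          (haveI : NeZero ℓ := ⟨(Fact.out : ℓ.Prime).ne_zero⟩
           zmodPowOrd p k₀ (kuriharaNumber f (p ^ k₀) ℓ ψ)) =
            min k₀ (zmodPowOrd p (k + 1)
              (ψp (galoisCohomology.localization (W.torsionGaloisModule ((p : ℤ) ^ k * (p : ℤ)))
                (Sum.inr vp) 1 (κ {vℓ}))))) :
    (haveI : NeZero ℓ := ⟨(Fact.out : ℓ.Prime).ne_zero⟩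
     zmodPowOrd p k₀ (kuriharaNumber f (p ^ k₀) ℓ ψ)) = min k₀ (F + 2 * localDivExponent W p ℓ P) := by
  obtain ⟨hpv, hgood⟩ := IsKolyvaginPrime.not_mem_and_hasGoodReductionAt W hKP hvℓ
  exact zmodPowOrd_kuriharaNumber_eq_of_kolyvaginKimDatum W f p ℓ k₀ P F m hp2 hgoodp hna hm1 hm2 hcycℓ hvℓ hvp hPT hEPℓ
    hEPp ψ hk hKP hu
    (kolyvaginKimDatum_of_isEulerSystem_of_primes''_canonicalTop W p S f ℓ k₀ k _ vℓ vp ψ hp2 hgoodp hna hc hirr D hT hD hPr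
      hKol hP'' Sτ hτq hτμ hP hDℓ hdiv hpv hgood hvp hread)
    hreg

end Law

/-! ### §3 The prime-set condition `𝒫″` is vacuous on the rows with THEOREM D's certificate `hbad` -/

section Rows

omit [W.IsElliptic] [W.IsGloballyMinimal] hp [Module.Free ℤ_[p] (W.tateModule p)] [Module.Finite ℤ_[p] (W.tateModule p)]
  [ContinuousSMul ℤ_[p] (W.tateModule p)] in
/-- **`𝒫″` from `hbad`** — on a row where every bad place `w ≠ p` has `E(ℚ_w)[p] = 0` (THEOREM D's certificate `hbad` of F31/F32/F37)
the prime-set condition `hP''` of THEOREM D″ holds for EVERY set of primes `Pr` (its premise «some non-zero `P ∈ E(ℚ_w)` with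
`p·P = 0`» is never met). Hence §2 (and §1) serve every row of the letter: F37 §3 is §2 with `hP'' :=` this lemma applied to `hbad`.
Pure logic; recorded so that the subsumption is a kernel fact and not a remark. [cite: MazurRubin2004, Thm. 3.2.4 and App. A] -/
theorem kolyvaginPrimeCondition''_of_torsion_eq_zero_bad (Pr : Set (HeightOneSpectrum (𝓞 ℚ)))
    (hbad : ∀ w : HeightOneSpectrum (𝓞 ℚ), ¬ W.HasGoodReductionAt w →
      ((primesEquiv w : Nat.Primes) : ℕ) ≠ p →
        ∀ P : (W.baseChange (w.adicCompletion ℚ)).toAffine.Point, p • P = 0 → P = 0) :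
    ∀ q ∈ Pr, ∀ w : HeightOneSpectrum (𝓞 ℚ), ¬ W.HasGoodReductionAt w →
      ((primesEquiv w : Nat.Primes) : ℕ) ≠ p →
      (∃ P : (W.baseChange (w.adicCompletion ℚ)).toAffine.Point, p • P = 0 ∧ P ≠ 0) →
        ¬ p ∣ orderOf ((((primesEquiv w : Nat.Primes) : ℕ) : ZMod ((primesEquiv q : Nat.Primes) : ℕ))) := by
  rintro q - w hw hwp ⟨P, hP0, hPne⟩
  exact absurd (hbad w hw hwp P hP0) hPne

end Rows

end Summit.BirchSwinnertonDyer.Rank1Residual.Ordinary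

end
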